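import Mathlib
import Summits.Ventures.HodgeRepro.Tier4.Common.AdelicDefs
import Summits.Ventures.HodgeRepro.Tier4.Line1.InfinitePrimes

/-!
# Tier4/Line1/SignAdele — `1` is not isolated in `U(W)(𝔸_k)`

Blind re-derivation cell `pub-hodge-repro`, Tier 4 (README §9–§10), seat t4-L1-p5 (prover, LINE L1, gen 0).
For a finite place `v` the sign adele `ε_v` (`−1` at `v`, `1` elsewhere; `ε_v² = 1`, `ε_v ≠ 1`) gives the scalar
matrix `ε_v • 1 ∈ U(W)(𝔸_k)` for EVERY `PlaneData` (scalars commute with `Ω` and `ε_v² = 1` preserves `B`); along the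
infinitely many places (`Tier4/Line1/InfinitePrimes.lean`) `ε_v → 1` in the restricted-product topology
(`RestrictedProduct.nhds_eq_map_structureMap`), so `(𝓝[≠] 1).NeBot` in `U(W)(𝔸_k)` — the input of Mathlib's
`IsHaarMeasure.nullSingletonClass` used in `Tier4/Line1/L2InfiniteGA.lean`.

Nothing here says anything about the status of the Hodge conjecture for CM abelian varieties, which is NOT proved
(HC_CM is NOT proved by anyone in this repository).
-/

set_option autoImplicit false
noncomputable section
namespace Summit.Ventures.HodgeRepro.Tier4.Line1
open NumberField IsDedekindDomain HeightOneSpectrum Topology Filter Common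
open scoped RestrictedProduct Classical

section Sign

variable (k : Type) [Field k] [NumberField k]

/-- the sign vector `(−1 at w = v, 1 elsewhere)` in `∏_w 𝓞_w` -/
theorem signVec_mem (v w : HeightOneSpectrum (𝓞 k)) :
    (if w = v then (-1 : w.adicCompletion k) else 1) ∈ w.adicCompletionIntegers k := by
  split_ifs
  · exact neg_mem (one_mem _)
  · exact one_mem _

/-- The sign adeles `ε_v := structureMap (signVec v)` tend to `1` along the cofinite filter on the places. -/
theorem tendsto_signAdele :
    Tendsto (fun v : HeightOneSpectrum (𝓞 k) =>
        (RestrictedProduct.structureMap (fun w : HeightOneSpectrum (𝓞 k) => w.adicCompletion k)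
          (fun w => (w.adicCompletionIntegers k : Set (w.adicCompletion k))) cofinite
          (fun w => ⟨if w = v then (-1 : w.adicCompletion k) else 1, signVec_mem k v w⟩) :
          FiniteAdeleRing (𝓞 k) k))
      cofinite (𝓝 (1 : FiniteAdeleRing (𝓞 k) k)) := by
  have hAopen : ∀ w : HeightOneSpectrum (𝓞 k),
      IsOpen (w.adicCompletionIntegers k : Set (w.adicCompletion k)) :=
    fun w => Valued.isOpen_valuationSubring _
  let x₁ : (w : HeightOneSpectrum (𝓞 k)) → (w.adicCompletionIntegers k : Set (w.adicCompletion k)) :=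
    fun w => ⟨1, one_mem _⟩
  have h1 : (1 : FiniteAdeleRing (𝓞 k) k) =
      RestrictedProduct.structureMap (fun w : HeightOneSpectrum (𝓞 k) => w.adicCompletion k)
        (fun w => (w.adicCompletionIntegers k : Set (w.adicCompletion k))) cofinite x₁ := by
    apply FiniteAdeleRing.ext
    intro w
    rfl
  rw [h1, RestrictedProduct.nhds_eq_map_structureMap hAopen]
  refine Tendsto.comp tendsto_map ?_
  rw [tendsto_pi_nhds]
  intro w
  refine tendsto_const_nhds.congr' ?_
  filter_upwards [eventually_cofinite_ne w] with v hv
  simp only [x₁]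
  congr 1
  rw [if_neg (Ne.symm hv)]

end Sign


section Instance

variable {k : Type} [Field k] [NumberField k] (W : PlaneData k)

/-- the sign adele as an element of `𝔸_k` -/
theorem signAdele_mul_self (v : HeightOneSpectrum (𝓞 k)) :
    let ε : Ad k := ((1 : InfiniteAdeleRing k),
      RestrictedProduct.structureMap (fun w : HeightOneSpectrum (𝓞 k) => w.adicCompletion k)
        (fun w => (w.adicCompletionIntegers k : Set (w.adicCompletion k))) cofinite
        (fun w => ⟨if w = v then (-1 : w.adicCompletion k) else 1, signVec_mem k v w⟩))
    ε * ε = 1 := by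
  intro ε
  refine Prod.ext ?_ ?_
  · show (1 : InfiniteAdeleRing k) * 1 = 1
    exact mul_one 1
  apply FiniteAdeleRing.ext
  intro w
  show (if w = v then (-1 : w.adicCompletion k) else 1) * (if w = v then (-1 : w.adicCompletion k) else 1) = 1
  split_ifs <;> simp

/-- the sign adele is not `1` -/
theorem signAdele_ne_one (v : HeightOneSpectrum (𝓞 k)) :
    let ε : Ad k := ((1 : InfiniteAdeleRing k),
      RestrictedProduct.structureMap (fun w : HeightOneSpectrum (𝓞 k) => w.adicCompletion k)
        (fun w => (w.adicCompletionIntegers k : Set (w.adicCompletion k))) cofinite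
        (fun w => ⟨if w = v then (-1 : w.adicCompletion k) else 1, signVec_mem k v w⟩))
    ε ≠ 1 := by
  intro ε h
  have h2 := congrArg (fun a : Ad k => a.2 v) h
  haveI : CharZero (v.adicCompletion k) :=
    charZero_of_injective_algebraMap (algebraMap k (v.adicCompletion k)).injective
  simp only [ε] at h2
  change (if v = v then (-1 : v.adicCompletion k) else 1) = 1 at h2
  rw [if_pos rfl] at h2
  have h3 : (2 : v.adicCompletion k) = 0 := by linear_combination (-1 : v.adicCompletion k) * h2
  exact two_ne_zero h3

/-- A scalar `ε` with `ε² = 1` gives an element of `U(W)(𝔸_k)`: the matrix `ε • 1`. -/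
theorem scalar_mem_unitaryGroup (ε : Ad k) (hε : ε * ε = 1) :
    ∃ g : GA W, (↑(↑g : GL4 k) : M4 k) = ε • (1 : M4 k) ∧ (↑(↑g⁻¹ : GL4 k) : M4 k) = ε • (1 : M4 k) := by
  have hgg : (ε • (1 : M4 k)) * (ε • (1 : M4 k)) = 1 := by
    rw [Matrix.smul_mul, Matrix.one_mul, smul_smul, hε, one_smul]
  let gU : GL4 k := ⟨ε • (1 : M4 k), ε • (1 : M4 k), hgg, hgg⟩
  have hmem : gU ∈ unitaryGroup W := by
    refine ⟨?_, ?_⟩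
    · show (ε • (1 : M4 k)) * adMat k W.Ω = adMat k W.Ω * (ε • (1 : M4 k))
      rw [Matrix.smul_mul, Matrix.one_mul, Matrix.mul_smul, Matrix.mul_one]
    · show (ε • (1 : M4 k)) * adMat k W.B * (ε • (1 : M4 k)).transpose = adMat k W.B
      rw [Matrix.transpose_smul, Matrix.transpose_one, Matrix.smul_mul, Matrix.one_mul,
        Matrix.mul_smul, Matrix.mul_one, smul_smul, hε, one_smul]
  exact ⟨⟨gU, hmem⟩, rfl, rfl⟩

/-- **`1` is not isolated in `U(W)(𝔸_k)`**: the sign elements `ε_v • 1 ∈ U(W)(𝔸_k)` are `≠ 1` and tend to `1`. -/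
theorem nhdsNE_one_neBot_GA : (𝓝[≠] (1 : GA W)).NeBot := by
  haveI := infinite_heightOneSpectrum k
  rw [← mem_closure_iff_nhdsWithin_neBot, mem_closure_iff_nhds]
  intro U hU
  -- pull `U` back through `Subtype.val` and the units embedding
  rw [nhds_subtype_eq_comap, mem_comap] at hU
  obtain ⟨V₁, hV₁, hV₁U⟩ := hU
  rw [Units.isEmbedding_embedProduct.nhds_eq_comap, mem_comap] at hV₁
  obtain ⟨V₂, hV₂, hV₂V₁⟩ := hV₁
  have e : Units.embedProduct (M4 k) (1 : GL4 k) = ((1 : M4 k), MulOpposite.op (1 : M4 k)) := by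
    rw [Units.embedProduct_apply, inv_one, Units.val_one]
  have hV₂' : V₂ ∈ 𝓝 ((1 : M4 k), MulOpposite.op (1 : M4 k)) := by
    rw [← e]
    exact hV₂
  rw [mem_nhds_prod_iff] at hV₂'
  obtain ⟨V₃, hV₃, V₄, hV₄, hV₃₄⟩ := hV₂'
  have hV₄' : (MulOpposite.op : M4 k → (M4 k)ᵐᵒᵖ) ⁻¹' V₄ ∈ 𝓝 (1 : M4 k) :=
    MulOpposite.continuous_op.continuousAt.preimage_mem_nhds hV₄
  -- the scalar matrices `ε • 1` near `1`
  have hcont : Continuous fun ε : Ad k => ε • (1 : M4 k) := continuous_id.smul continuous_const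
  have hVε : (fun ε : Ad k => ε • (1 : M4 k)) ⁻¹' (V₃ ∩ MulOpposite.op ⁻¹' V₄) ∈ 𝓝 (1 : Ad k) := by
    apply hcont.continuousAt.preimage_mem_nhds
    simpa using Filter.inter_mem hV₃ hV₄'
  have hVε' : ((fun ε : Ad k => ε • (1 : M4 k)) ⁻¹' (V₃ ∩ MulOpposite.op ⁻¹' V₄) :
      Set (InfiniteAdeleRing k × FiniteAdeleRing (𝓞 k) k)) ∈
      𝓝 (((1 : InfiniteAdeleRing k), (1 : FiniteAdeleRing (𝓞 k) k)) :
        InfiniteAdeleRing k × FiniteAdeleRing (𝓞 k) k) := hVε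
  rw [mem_nhds_prod_iff] at hVε'
  obtain ⟨Vinf, hVinf, Vf, hVf, hVprod⟩ := hVε'
  -- a place `v` with `ε_v ∈ Vf`
  obtain ⟨v, hv⟩ := ((tendsto_signAdele k).eventually_mem hVf).exists
  obtain ⟨g, hg, hg'⟩ := scalar_mem_unitaryGroup W _ (signAdele_mul_self v)
  refine ⟨g, ?_, ?_⟩
  · -- `g ∈ U`
    apply hV₁U
    apply hV₂V₁
    show ((↑(↑g : GL4 k) : M4 k), MulOpposite.op (↑(↑g⁻¹ : GL4 k) : M4 k)) ∈ V₂
    rw [hg, hg']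
    apply hV₃₄
    have hε : ((1 : InfiniteAdeleRing k), RestrictedProduct.structureMap
        (fun w : HeightOneSpectrum (𝓞 k) => w.adicCompletion k)
        (fun w => (w.adicCompletionIntegers k : Set (w.adicCompletion k))) cofinite
        (fun w => ⟨if w = v then (-1 : w.adicCompletion k) else 1, signVec_mem k v w⟩)) ∈
        Vinf ×ˢ Vf := ⟨mem_of_mem_nhds hVinf, hv⟩
    have := hVprod hε
    exact ⟨this.1, this.2⟩
  · -- `g ≠ 1`
    intro h1
    have hne := signAdele_ne_one v
    simp only at hne
    apply hne
    have h2 : (↑(↑g : GL4 k) : M4 k) 0 0 = (1 : M4 k) 0 0 := by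
      rw [h1]
      rfl
    rw [hg, Matrix.smul_apply, Matrix.one_apply_eq, smul_eq_mul, mul_one] at h2
    exact h2

end Instance

end Summit.Ventures.HodgeRepro.Tier4.Line1
end
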